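import Summits.ResolutionOfSingularities.ResolutionOfSingularities.Theorems.ValuativePatchingRelFormatUpgrade
import Summits.ResolutionOfSingularities.ResolutionOfSingularities.Theorems.ValuativePatchingRelPrincipalizationDimThree
import Literature.AlgebraicGeometry.Resolution.QuasiExcellentSchemes
import Literature.AlgebraicGeometry.Resolution.ExcellentRingsFieldProofs
import Literature.AlgebraicGeometry.Resolution.AlterationsDimension
import Literature.AlgebraicGeometry.Resolution.AlterationsResolution
import Literature.AlgebraicGeometry.Resolution.RegularLocusDense
import Literature.AlgebraicGeometry.Resolution.PrincipalizationToResolution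
import HarnessLib

/-!
# Crux `PatchingRel` (stmt-ResolutionOfSingularities-0642), line `sandwiched-gluing` (v3 cut),
# stub D3 `stub_sandwichedStrongBlowup_dim3_of_cossartPiltant`

**The strong blow-up atom SAND⁺ᵇ is KNOWN in dimension three, modulo the two Cossart–Piltant
named facts.** The v3 cut of the line reduced Zariski's patching to the atom SAND⁺ᵇ(p)
(`SandwichedStrongBlowupResolution p`): a sandwiched variety `V` (integral, proper birational
over a regular variety `U` of finite type over `k`) admits ONE `Sing V`-admissible blowing up
`Bl_J V → V` (`J ≠ 0`, `V(J) ⊆ Sing V`) with regular source. The leaf's remark that this atom is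
"open in dimension `≥ 4`" is repaired here into a theorem: in dimension `3` it follows from

* `CossartPiltant2019General` — Cossart–Piltant 2019, Thm. 1.1 as printed: a reduced separated
  Noetherian quasi-excellent scheme of dimension `≤ 3` has a resolution `φ : Y → V` which is an
  isomorphism over `Reg V` (`QuasiExcellentSchemes.lean`);
* `CossartPiltant2019Principalization` — loc. cit., Prop. 4.4: principalization of non-zero
  ideal sheaves on regular excellent Noetherian integral threefolds by blowing ups in regular
  centres (`Principalization.lean`), brought into blow-up format (ONE `V(I)`-supported blowing up
  with regular source making `I` an effective Cartier divisor) by the sibling theorem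
  `formatPrincipalization_dim3_of_cossartPiltant`;

via the c1 FORMAT UPGRADE `exists_isBlowup_supported_isRegular_of_isIso_over`
(`ValuativePatchingRelFormatUpgrade.lean`: strong resolution + Axiom 4 on its source ⇒ one
`Sing`-supported blowing up with regular source, through Raynaud–Gruson `U`-admissible
domination, Stacks 080A backwards and Temkin's Lemma 2.1.4).

Proof of `exists_isBlowup_singSupported_isRegular_dim3_of_cossartPiltant`. `V` is integral,
separated and of finite type over `k`, hence separated, Noetherian, reduced and — finite type
algebras over a field being excellent (`Stacks07QW_field_holds`, proved in the tree) —
quasi-excellent; Thm. 1.1 gives `φ : Y → V`, proper birational, `Y` regular, an isomorphism over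
the open `W = Reg V ∋ ξ_V`. The source `Y` is integral (reduced and birational onto the integral
`V`), Noetherian and excellent (of finite type over `k` through `φ`), and of dimension `3`: a
resolution is an alteration (`IsResolution.isPurelyInseparableAlteration`) and alterations
preserve the dimension of a variety (de Jong 1996, 2.20, `IsAlteration.topologicalKrullDim_eq`).
So Prop. 4.4 in blow-up format is Axiom 4 on `Y`, and the format upgrade yields the blowing up.
The sandwiched data (the regular roof `U`, birationality of `η : V → U`) are not used beyond the
structure morphism `η ≫ f : V → Spec k`: `sandwichedStrongBlowup_dim3_of_cossartPiltant` and the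
registered universe-`0` stub are the specialisations to the SAND⁺ᵇ format.

## References

* V. Cossart, O. Piltant, *Resolution of singularities of arithmetical threefolds*, J. Algebra
  529 (2019) 268–535, Thm. 1.1 and Prop. 4.4. [CossartPiltant2019]
* O. Piltant, *An axiomatic version of Zariski's patching theorem*, RACSAM 107 (2013) 91–121,
  §2 Axiom 4, Prop. 5.1. [Piltant2013]
* A. J. de Jong, *Smoothness, semi-stability and alterations*, Publ. Math. IHÉS 83 (1996),
  2.20. [DeJong1996]
* The Stacks Project, Tags 07QW, 081T. [StacksProject]
-/

-- `Summit.<Summit>.<Sub>.Theorems` with `Sub = Summit` (single-conjunct summit, D-0017): the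
-- duplicated namespace component is the tree layout.
set_option linter.dupNamespace false

noncomputable section

namespace Summit.ResolutionOfSingularities.ResolutionOfSingularities.Theorems

open CategoryTheory AlgebraicGeometry TopologicalSpace
open Literature.AlgebraicGeometry.Resolution

universe u

/-- **An integral variety of dimension three has a `Sing`-admissible blowing up with regular
source, modulo Cossart–Piltant 2019, Thm. 1.1 and Prop. 4.4.** Let `V` be an integral scheme,
separated and of finite type over a field `k`, with `dim V = 3`. Granting
`CossartPiltant2019General` (Thm. 1.1: strong resolution `φ : Y → V` of reduced separated
Noetherian quasi-excellent schemes of dimension `≤ 3`, an isomorphism over `Reg V`) and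
`CossartPiltant2019Principalization` (Prop. 4.4: principalization on regular excellent
threefolds, here on `Y`, which is integral, excellent and of dimension `3` as an alteration of
`V`), there is a non-zero ideal sheaf `J` on `V`, cosupported in the singular locus, whose
blowing up `π : V₁ = Bl_J V → V` has regular source — by the format upgrade
`exists_isBlowup_supported_isRegular_of_isIso_over`.
[cite: CossartPiltant2019, Thm. 1.1 and Prop. 4.4] -/
theorem exists_isBlowup_singSupported_isRegular_dim3_of_cossartPiltant
    (hG : CossartPiltant2019General.{u}) (hP : CossartPiltant2019Principalization.{u})
    {k : Type u} [Field k] (V : Scheme.{u}) (g : V ⟶ Spec (.of k)) [IsSeparated g]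
    [LocallyOfFiniteType g] [QuasiCompact g] [IsIntegral V] (hdim : topologicalKrullDim V = 3) :
    ∃ (J : V.IdealSheafData) (V1 : Scheme.{u}) (π : V1 ⟶ V), J ≠ ⊥ ∧
      (∀ x : V, x ∈ J.support → ¬ IsRegularLocalRing (V.presheaf.stalk x)) ∧ IsBlowup π J ∧
      Scheme.IsRegular V1 := by
  -- `V` is separated, Noetherian, reduced and quasi-excellent
  haveI : V.IsSeparated := Scheme.isSeparated_of_isSeparated_over g
  haveI : IsNoetherian V := Scheme.isNoetherian_of_finiteType_over_field g
  have hqe : Scheme.IsQuasiExcellent V :=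
    Scheme.isQuasiExcellent_of_locallyOfFiniteType Stacks07QW_field_holds g
  -- Cossart–Piltant Thm. 1.1: a strong resolution `φ : Y → V`, an isomorphism over `W = Reg V`
  obtain ⟨Y, φ, hres, W, hW, hiso⟩ := hG V hqe hdim.le
  haveI := hres.isProper
  haveI := hiso
  haveI : IsIntegral Y := by
    haveI := hres.isRegular.isReduced
    exact hres.isBirational.isIntegral
  have hgenW : genericPoint V ∈ W := by
    show genericPoint V ∈ (W : Set V)
    rw [hW]
    apply Scheme.genericPoints_subset_regularLocus
    rw [genericPoints_eq_singleton]
    rfl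
  -- `Y` is Noetherian and excellent (of finite type over `k` via `φ ≫ g`) of dimension `3`
  -- (a resolution is an alteration, and alterations preserve the dimension, de Jong 2.20)
  haveI : IsNoetherian Y := Scheme.isNoetherian_of_finiteType_over_field (φ ≫ g)
  have hexcY : Scheme.IsExcellent Y :=
    Scheme.isExcellent_of_locallyOfFiniteType Stacks07QW_field_holds (φ ≫ g)
  have hdimY : topologicalKrullDim Y = 3 := by
    rw [← hdim]
    exact IsAlteration.topologicalKrullDim_eq g hres.isPurelyInseparableAlteration.isAlteration
  -- Axiom 4 on `Y`: Cossart–Piltant Prop. 4.4 in blow-up format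
  have hA4 : ∀ I' : Y.IdealSheafData, I' ≠ ⊥ →
      ∃ (Q : Y.IdealSheafData) (Y₁ : Scheme.{u}) (σ : Y₁ ⟶ Y),
        (Q.support : Set Y) ⊆ I'.support ∧ IsBlowup σ Q ∧ Scheme.IsRegular Y₁ ∧
          IsEffectiveCartier (I'.comap σ) := fun I' hI' =>
    formatPrincipalization_dim3_of_cossartPiltant hP Y hres.isRegular hexcY hdimY I' hI'
  -- the format upgrade
  obtain ⟨Q', V'', ρ, hQ', hQ'T, hρ, hreg''⟩ :=
    exists_isBlowup_supported_isRegular_of_isIso_over φ W hgenW hA4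
  refine ⟨Q', V'', ρ, hQ', fun x hx hxreg => ?_, hρ, hreg''⟩
  have : x ∈ (W : Set V) := by rw [hW]; exact hxreg
  exact hQ'T hx this

/-- **SAND⁺ᵇ in dimension three, modulo Cossart–Piltant 2019, Thm. 1.1 and Prop. 4.4**: a
sandwiched threefold `V` (integral, proper over a variety `U` separated of finite type over `k`)
admits a non-zero `Sing V`-admissible blowing up `Bl_J V → V` with regular source. The
structure morphism `η ≫ f : V → Spec k` is separated, of finite type and quasi-compact, so this
is `exists_isBlowup_singSupported_isRegular_dim3_of_cossartPiltant`; the regularity of the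
roof `U` and the birationality of `η` — part of the SAND⁺ᵇ format — are not needed in
dimension `3`. [cite: CossartPiltant2019, Thm. 1.1 and Prop. 4.4] -/
theorem sandwichedStrongBlowup_dim3_of_cossartPiltant (hG : CossartPiltant2019General.{u})
    (hP : CossartPiltant2019Principalization.{u}) {k : Type u} [Field k] (U V : Scheme.{u})
    (f : U ⟶ Spec (.of k)) (η : V ⟶ U) [IsSeparated f] [LocallyOfFiniteType f] [QuasiCompact f]
    [IsIntegral V] [IsProper η] (hdim : topologicalKrullDim V = 3) :
    ∃ (J : V.IdealSheafData) (V1 : Scheme.{u}) (π : V1 ⟶ V), J ≠ ⊥ ∧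
      (∀ x : V, x ∈ J.support → ¬ IsRegularLocalRing (V.presheaf.stalk x)) ∧ IsBlowup π J ∧
      Scheme.IsRegular V1 :=
  exists_isBlowup_singSupported_isRegular_dim3_of_cossartPiltant hG hP V (η ≫ f) hdim

/-- **Stub D3 `stub_sandwichedStrongBlowup_dim3_of_cossartPiltant` of line `sandwiched-gluing`**
(crux `PatchingRel`, stmt-ResolutionOfSingularities-0642), the universe-`0` instance of
`sandwichedStrongBlowup_dim3_of_cossartPiltant` in the registered SAND⁺ᵇ format: modulo
Cossart–Piltant 2019, Thm. 1.1 (`CossartPiltant2019General`) and Prop. 4.4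
(`CossartPiltant2019Principalization`), every sandwiched threefold admits a non-zero
`Sing`-admissible blowing up with regular source. [cite: CossartPiltant2019, Thm. 1.1 and Prop. 4.4] -/
theorem stub_sandwichedStrongBlowup_dim3_of_cossartPiltant :
    Literature.AlgebraicGeometry.Resolution.CossartPiltant2019General.{0} →
    Literature.AlgebraicGeometry.Resolution.CossartPiltant2019Principalization.{0} →
    ∀ (k : Type) [Field k] (U V : Scheme.{0}) (f : U ⟶ Spec (.of k)) (η : V ⟶ U) [IsSeparated f]
      [LocallyOfFiniteType f] [QuasiCompact f] [IsIntegral V] [IsProper η], IsBirational η →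
      topologicalKrullDim V = 3 → ∃ (J : V.IdealSheafData) (V1 : Scheme.{0}) (π : V1 ⟶ V), J ≠ ⊥ ∧
        (∀ x : V, x ∈ J.support → ¬ IsRegularLocalRing (V.presheaf.stalk x)) ∧ IsBlowup π J ∧
        Scheme.IsRegular V1 :=
  fun hG hP _ _ U V f η _ _ _ _ _ _ hdim =>
    sandwichedStrongBlowup_dim3_of_cossartPiltant hG hP U V f η hdim

end Summit.ResolutionOfSingularities.ResolutionOfSingularities.Theorems

end
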